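import Literature.MathematicalPhysics.QuantumFieldTheory.OSSuperposedVectors
import Literature.MathematicalPhysics.QuantumFieldTheory.OSShiftAverageBound
import Literature.Analysis.FunctionSpaces.SchwartzParametric
import HarnessLib

/-!
# Damping a superposed OS vector by the time average of its family (OS II, Ch. VI.1)

Topic `Literature/MathematicalPhysics/QuantumFieldTheory`. Osterwalder–Schrader II (Comm. Math. Phys. 42
(1975)), Ch. VI.1: the norm of `e^{-LH} V` for a *superposed* vector `V = ∫ g(x) v(G x) dx` of the OS
Hilbert space is estimated by the OS vector of a *time-averaged* test function. Precisely
(`norm_shiftH_integral_smul_le`): for a continuous weight `ρ ≥ 0` supported in `[0, L]` with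
`∫ ρ = 1`,

  `‖e^{-LH} V‖ ≤ ‖∫ ρ(s) e^{-sH} V ds‖ = ‖v(K)‖`

for every positive-time Schwartz function `K` with
`K(y) = ∫_{ℝ×X} ρ(s) g(x) (G x)(y - |s| e₀) d(s, x)` — the average over `s` of the translates of the
family, a genuine test function whose Schwartz seminorms (hence, by E0', whose OS norm) can be
controlled. Ingredients: the vector-level monotonicity bound `norm_shiftH_le_norm_average`
(`OSShiftAverageBound`), `e^{-sH} v(F) = v(F(· - s e₀))` (`shiftH_ι`, `shiftOp_δ`), and the
superposed-vector identity `ι_δ_mkGen_eq_integral` (`OSSuperposedVectors`) on the parameter space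
`ℝ × X` with the family `(s, x) ↦ G x (· - |s| e₀)`, which is jointly continuous
(`continuous_compSubConstCLM₂`, equicontinuity of translations from
`SchwartzMap.seminorm_compSubConstCLM_le`).

## References

* K. Osterwalder, R. Schrader, *Axioms for Euclidean Green's functions II*, Comm. Math. Phys.
  42 (1975) 281–305, Ch. VI.1 pp. 297–298. [OsterwalderSchraderCMP1975]
-/

noncomputable section

open MeasureTheory Set Filter intervalIntegral
open _root_.Topology
open scoped InnerProductSpace NNReal ComplexConjugate SchwartzMap

namespace Literature.MathematicalPhysics.QuantumFieldTheory

/-! ### Joint continuity of translations -/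

section JointContinuity

variable {V : Type*} [NormedAddCommGroup V] [NormedSpace ℝ V] {Y : Type*} [TopologicalSpace Y]

/-- **Joint continuity of translations on the Schwartz space**: if `c : Y → V` and
`G : Y → 𝓢(V, ℂ)` are continuous then so is `y ↦ (G y)(· - c y)` (equicontinuity of the
translations `τ_v` for `v` bounded, `SchwartzMap.seminorm_compSubConstCLM_le`, plus separate
continuity in `v`, `continuous_compSubConstCLM`). [folklore] -/
theorem continuous_compSubConstCLM₂ {c : Y → V} (hc : Continuous c) {G : Y → 𝓢(V, ℂ)} (hG : Continuous G) :
    Continuous fun y => SchwartzMap.compSubConstCLM ℂ (c y) (G y) := by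
  refine continuous_iff_continuousAt.2 fun y₀ => ?_
  rw [ContinuousAt, (schwartz_withSeminorms ℂ V ℂ).tendsto_nhds]
  rintro ⟨k, n⟩ ε hε
  rw [SchwartzMap.schwartzSeminormFamily_apply]
  -- split: `τ_{c y}(G y) - τ_{c y₀}(G y₀) = τ_{c y}(G y - G y₀) + (τ_{c y}(G y₀) - τ_{c y₀}(G y₀))`
  have hsep : Tendsto (fun y => SchwartzMap.compSubConstCLM ℂ (c y) (G y₀)) (𝓝 y₀)
      (𝓝 (SchwartzMap.compSubConstCLM ℂ (c y₀) (G y₀))) :=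
    ((QuantumLattice.continuous_compSubConstCLM (𝕜 := ℂ) (G y₀)).comp hc).tendsto y₀
  rw [(schwartz_withSeminorms ℂ V ℂ).tendsto_nhds] at hsep
  have h2 := hsep (k, n) (ε / 2) (by positivity)
  rw [SchwartzMap.schwartzSeminormFamily_apply] at h2
  -- the first term: seminorms of `G y - G y₀` tend to `0`, and `‖c y‖` stays bounded
  have hG0 : Tendsto (fun y => G y - G y₀) (𝓝 y₀) (𝓝 0) := by
    have := (hG.tendsto y₀).sub (tendsto_const_nhds (x := G y₀)); rwa [sub_self] at this
  have hpk : Tendsto (fun y => SchwartzMap.seminorm ℂ k n (G y - G y₀)) (𝓝 y₀) (𝓝 0) := by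
    have h := ((schwartz_withSeminorms ℂ V ℂ).continuous_seminorm (k, n)).tendsto 0
    rw [map_zero] at h
    exact h.comp hG0
  have hp0 : Tendsto (fun y => SchwartzMap.seminorm ℂ 0 n (G y - G y₀)) (𝓝 y₀) (𝓝 0) := by
    have h := ((schwartz_withSeminorms ℂ V ℂ).continuous_seminorm (0, n)).tendsto 0
    rw [map_zero] at h
    exact h.comp hG0
  have hcb : ∀ᶠ y in 𝓝 y₀, ‖c y‖ ≤ ‖c y₀‖ + 1 := by
    have h := (hc.tendsto y₀).norm
    exact (h.eventually (Iic_mem_nhds (lt_add_one ‖c y₀‖))).mono fun y hy => hy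
  set B : ℝ := 2 ^ k * (1 + (‖c y₀‖ + 1)) ^ k with hB
  have hB0 : 0 < B := by positivity
  have h1 : ∀ᶠ y in 𝓝 y₀, B * (SchwartzMap.seminorm ℂ k n (G y - G y₀) + SchwartzMap.seminorm ℂ 0 n (G y - G y₀)) < ε / 2 := by
    have h := (hpk.add hp0).const_mul B
    rw [add_zero, mul_zero] at h
    exact h.eventually (Iio_mem_nhds (by positivity))
  filter_upwards [h1, h2, hcb] with y hy1 hy2 hyc
  have hsplit : SchwartzMap.compSubConstCLM ℂ (c y) (G y) - SchwartzMap.compSubConstCLM ℂ (c y₀) (G y₀) =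
      SchwartzMap.compSubConstCLM ℂ (c y) (G y - G y₀) +
        (SchwartzMap.compSubConstCLM ℂ (c y) (G y₀) - SchwartzMap.compSubConstCLM ℂ (c y₀) (G y₀)) := by
    rw [map_sub]; abel
  rw [hsplit]
  refine (map_add_le_add _ _ _).trans_lt ?_
  have hfirst : SchwartzMap.seminorm ℂ k n (SchwartzMap.compSubConstCLM ℂ (c y) (G y - G y₀)) < ε / 2 := by
    refine (SchwartzMap.seminorm_compSubConstCLM_le _ k n _).trans_lt (lt_of_le_of_lt ?_ hy1)
    refine mul_le_mul_of_nonneg_right ?_ (by positivity)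
    rw [hB]
    gcongr
  linarith

end JointContinuity

/-! ### The damped superposed vector -/

section Damping

variable {d : ℕ} [NeZero d]

open Literature.MathematicalPhysics.QuantumLattice (SchwingerFamily IsPositiveTimeMulti)
open Literature.MathematicalPhysics.QuantumLattice.SchwingerFamily
open Literature.MathematicalPhysics.QuantumLattice.SchwingerFamily.OSSpace

/-- Positivity in time is preserved by forward time translations (re-export under a short name). [folklore] -/
theorem isPositiveTimeMulti_translate {nG : ℕ} {F : 𝓢((Fin nG → EuclideanSpace ℝ (Fin d)), ℂ)}
    (hF : IsPositiveTimeMulti F) {t : ℝ} (ht : 0 ≤ t) : IsPositiveTimeMulti (QuantumLattice.translateMulti (timeVec t) F) :=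
  Literature.MathematicalPhysics.QuantumLattice.SchwingerFamily.IsPositiveTimeMulti.translateMulti_timeVec hF ht

variable {𝔖 : SchwingerFamily (EuclideanSpace ℝ (Fin d))}

/-- **The semigroup on generator vectors is translation of the test function**:
`e^{-tH} v(F) = v(F(· - t e₀))` for `t ≥ 0`. [folklore] -/
theorem shiftH_ι_δ_mkGen (hE1 : 𝔖.IsEuclideanCovariant) (hE2 : 𝔖.IsOSReflectionPositive) {nG : ℕ}
    (F : 𝓢((Fin nG → EuclideanSpace ℝ (Fin d)), ℂ)) (hF : IsPositiveTimeMulti F) {t : ℝ} (ht : 0 ≤ t) :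
    shiftH hE2 t (ι 𝔖 hE2 (δ 𝔖 hE2 (mkGen F hF))) =
      ι 𝔖 hE2 (δ 𝔖 hE2 (mkGen (QuantumLattice.translateMulti (timeVec t) F) (isPositiveTimeMulti_translate hF ht))) := by
  rw [shiftH_ι hE1 t, shiftOp_δ, shiftGen_of_nonneg ht]

/-- Forward time translation contracts the OS norm of a generator vector: `‖v(F(· - te₀))‖ ≤ ‖v(F)‖`. [folklore] -/
theorem norm_ι_δ_translate_le (hE1 : 𝔖.IsEuclideanCovariant) (hE2 : 𝔖.IsOSReflectionPositive) {nG : ℕ}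
    (F : 𝓢((Fin nG → EuclideanSpace ℝ (Fin d)), ℂ)) (hF : IsPositiveTimeMulti F) {t : ℝ} (ht : 0 ≤ t) :
    ‖ι 𝔖 hE2 (δ 𝔖 hE2 (mkGen (QuantumLattice.translateMulti (timeVec t) F) (isPositiveTimeMulti_translate hF ht)))‖ ≤
      ‖ι 𝔖 hE2 (δ 𝔖 hE2 (mkGen F hF))‖ := by
  rw [← shiftH_ι_δ_mkGen hE1 hE2 F hF ht]
  exact norm_shiftH_le hE1 t _

variable {X : Type*} [NormedAddCommGroup X]

/-- The translated family `(s, x) ↦ (G x)(· - |s| e₀)`. [folklore] -/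
def translatedFamily {nG : ℕ} (G : X → 𝓢((Fin nG → EuclideanSpace ℝ (Fin d)), ℂ)) (z : ℝ × X) :
    𝓢((Fin nG → EuclideanSpace ℝ (Fin d)), ℂ) :=
  QuantumLattice.translateMulti (timeVec |z.1|) (G z.2)

/-- The translated family is jointly continuous. [folklore] -/
theorem continuous_translatedFamily {nG : ℕ} {G : X → 𝓢((Fin nG → EuclideanSpace ℝ (Fin d)), ℂ)}
    (hG : Continuous G) : Continuous (translatedFamily G) := by
  unfold translatedFamily QuantumLattice.translateMulti
  exact continuous_compSubConstCLM₂ (continuous_pi fun _ => (QuantumLattice.continuous_single_time d).comp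
    (continuous_abs.comp continuous_fst)) (hG.comp continuous_snd)

omit [NormedAddCommGroup X] in
/-- The translated family is positive-time. [folklore] -/
theorem isPositiveTimeMulti_translatedFamily {nG : ℕ} {G : X → 𝓢((Fin nG → EuclideanSpace ℝ (Fin d)), ℂ)}
    (hpos : ∀ x, IsPositiveTimeMulti (G x)) (z : ℝ × X) : IsPositiveTimeMulti (translatedFamily G z) :=
  isPositiveTimeMulti_translate (hpos z.2) (abs_nonneg _)

/-- `‖(te₀, …, te₀)‖ ≤ |t|`. [folklore] -/
theorem norm_const_timeVec_le (nG : ℕ) (t : ℝ) : ‖(fun _ : Fin nG => (timeVec t : EuclideanSpace ℝ (Fin d)))‖ ≤ |t| := by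
  refine (pi_norm_le_iff_of_nonneg (abs_nonneg _)).2 fun _ => ?_
  rw [timeVec, PiLp.norm_single, Real.norm_eq_abs]

/-- Seminorms of the translated family grow polynomially. [folklore] -/
theorem growth_translatedFamily {nG : ℕ} {G : X → 𝓢((Fin nG → EuclideanSpace ℝ (Fin d)), ℂ)}
    (hgrowth : ∀ k l : ℕ, ∃ (C : ℝ) (N : ℕ), ∀ x, SchwartzMap.seminorm ℂ k l (G x) ≤ C * (1 + ‖x‖) ^ N) (k l : ℕ) :
    ∃ (C : ℝ) (N : ℕ), ∀ z, SchwartzMap.seminorm ℂ k l (translatedFamily G z) ≤ C * (1 + ‖z‖) ^ N := by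
  obtain ⟨C₁, N₁, h₁⟩ := hgrowth k l
  obtain ⟨C₂, N₂, h₂⟩ := hgrowth 0 l
  refine ⟨2 ^ k * (|C₁| + |C₂|), k + max N₁ N₂, fun z => ?_⟩
  have hz1 : |z.1| ≤ ‖z‖ := by rw [← Real.norm_eq_abs]; exact norm_fst_le z
  have hz2 : ‖z.2‖ ≤ ‖z‖ := norm_snd_le z
  have hone : (1 : ℝ) ≤ 1 + ‖z‖ := by linarith [norm_nonneg z]
  refine (SchwartzMap.seminorm_compSubConstCLM_le (G z.2) k l _).trans ?_
  have ht : ‖(fun _ : Fin nG => (timeVec |z.1| : EuclideanSpace ℝ (Fin d)))‖ ≤ ‖z‖ :=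
    (norm_const_timeVec_le nG |z.1|).trans (by rw [abs_abs]; exact hz1)
  have e1 : SchwartzMap.seminorm ℂ k l (G z.2) ≤ |C₁| * (1 + ‖z‖) ^ max N₁ N₂ :=
    (h₁ z.2).trans ((mul_le_mul_of_nonneg_right (le_abs_self _) (by positivity)).trans
      (mul_le_mul_of_nonneg_left ((pow_le_pow_left₀ (by positivity) (by linarith) N₁).trans
        (pow_le_pow_right₀ hone (le_max_left _ _))) (abs_nonneg _)))
  have e2 : SchwartzMap.seminorm ℂ 0 l (G z.2) ≤ |C₂| * (1 + ‖z‖) ^ max N₁ N₂ :=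
    (h₂ z.2).trans ((mul_le_mul_of_nonneg_right (le_abs_self _) (by positivity)).trans
      (mul_le_mul_of_nonneg_left ((pow_le_pow_left₀ (by positivity) (by linarith) N₂).trans
        (pow_le_pow_right₀ hone (le_max_right _ _))) (abs_nonneg _)))
  calc 2 ^ k * (1 + ‖fun _ : Fin nG => (timeVec |z.1| : EuclideanSpace ℝ (Fin d))‖) ^ k *
        (SchwartzMap.seminorm ℂ k l (G z.2) + SchwartzMap.seminorm ℂ 0 l (G z.2))
      ≤ 2 ^ k * (1 + ‖z‖) ^ k * ((|C₁| + |C₂|) * (1 + ‖z‖) ^ max N₁ N₂) := by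
        gcongr
        · linarith
    _ = 2 ^ k * (|C₁| + |C₂|) * (1 + ‖z‖) ^ (k + max N₁ N₂) := by rw [pow_add]; ring

/-- A continuous function vanishing off `[0, L]` vanishes at `0`. [folklore] -/
theorem eq_zero_at_zero_of_support {ρ : ℝ → ℝ} (hρ : Continuous ρ) {L : ℝ} (hρsupp : ∀ s, s ∉ Icc 0 L → ρ s = 0) : ρ 0 = 0 := by
  have hlim : Tendsto ρ (𝓝[<] 0) (𝓝 (ρ 0)) := (hρ.tendsto 0).mono_left nhdsWithin_le_nhds
  have hzero : Tendsto ρ (𝓝[<] 0) (𝓝 0) := by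
    refine tendsto_const_nhds.congr' ?_
    filter_upwards [self_mem_nhdsWithin] with s (hs : s < 0)
    exact (hρsupp s fun h => not_le.2 hs h.1).symm
  exact tendsto_nhds_unique hlim hzero

variable [MeasurableSpace X] [OpensMeasurableSpace X] [SecondCountableTopology X] {μ : Measure X} [SFinite μ]

/-- **The damped superposed vector is bounded by the averaged test function** (OS II, Ch. VI.1): with
`V = ∫ g(x) v(G x) dμ` and a weight `ρ ≥ 0` vanishing off `[0, L]` (`L > 0`, `∫₀ᴸ ρ = 1`),
`‖e^{-LH} V‖ ≤ ‖v(K)‖` for every positive-time `K` with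
`K(y) = ∫ ρ(s) g(x) (G x)(y - |s|e₀) d(s, x)`. [cite: OsterwalderSchraderCMP1975, Ch. VI.1 pp. 297–298] -/
theorem norm_shiftH_integral_smul_le (hE1 : 𝔖.IsEuclideanCovariant) (hE2 : 𝔖.IsOSReflectionPositive)
    {nG : ℕ} (G : X → 𝓢((Fin nG → EuclideanSpace ℝ (Fin d)), ℂ)) (hG : Continuous G)
    (hgrowth : ∀ k l : ℕ, ∃ (C : ℝ) (N : ℕ), ∀ x, SchwartzMap.seminorm ℂ k l (G x) ≤ C * (1 + ‖x‖) ^ N)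
    (hpos : ∀ x, IsPositiveTimeMulti (G x))
    (hv : ∃ (C : ℝ) (N : ℕ), ∀ x, ‖ι 𝔖 hE2 (δ 𝔖 hE2 (mkGen (G x) (hpos x)))‖ ≤ C * (1 + ‖x‖) ^ N)
    (g : X → ℂ) (hg : Continuous g) (hgi : ∀ N : ℕ, Integrable (fun x => (1 + ‖x‖) ^ N * ‖g x‖) μ)
    {ρ : ℝ → ℝ} (hρ : Continuous ρ) {L : ℝ} (hL : 0 < L) (hρ0 : ∀ s, 0 ≤ ρ s) (hρ1 : ∫ s in 0..L, ρ s = 1)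
    (hρsupp : ∀ s, s ∉ Icc 0 L → ρ s = 0)
    (K : 𝓢((Fin nG → EuclideanSpace ℝ (Fin d)), ℂ)) (hKpos : IsPositiveTimeMulti K)
    (hK : ∀ y, K y = ∫ z : ℝ × X, ((ρ z.1 : ℂ) * g z.2) * translatedFamily G z y ∂((volume : Measure ℝ).prod μ)) :
    ‖shiftH hE2 L (∫ x, g x • ι 𝔖 hE2 (δ 𝔖 hE2 (mkGen (G x) (hpos x))) ∂μ)‖ ≤
      ‖ι 𝔖 hE2 (δ 𝔖 hE2 (mkGen K hKpos))‖ := by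
  set vG : X → OSHilbert 𝔖 hE2 := fun x => ι 𝔖 hE2 (δ 𝔖 hE2 (mkGen (G x) (hpos x))) with hvGdef
  set vT : ℝ × X → OSHilbert 𝔖 hE2 := fun z => ι 𝔖 hE2 (δ 𝔖 hE2 (mkGen (translatedFamily G z)
    (isPositiveTimeMulti_translatedFamily hpos z))) with hvTdef
  set V : OSHilbert 𝔖 hE2 := ∫ x, g x • vG x ∂μ with hV
  -- step 1: the vector-level monotonicity bound
  refine (norm_shiftH_le_norm_average hE1 V hρ hL.le (fun s _ => hρ0 s) hρ1).trans (le_of_eq ?_)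
  congr 1
  -- bounds
  obtain ⟨Cv, Nv, hCv⟩ := hv
  have hvG : Integrable (fun x => g x • vG x) μ := by
    refine ((hgi Nv).const_mul |Cv|).mono' ((hg.smul (continuous_ι_δ_mkGen hE2 hG hpos)).aestronglyMeasurable)
      (Eventually.of_forall fun x => ?_)
    rw [norm_smul]
    calc ‖g x‖ * ‖vG x‖ ≤ ‖g x‖ * (Cv * (1 + ‖x‖) ^ Nv) := mul_le_mul_of_nonneg_left (hCv x) (norm_nonneg _)
      _ ≤ ‖g x‖ * (|Cv| * (1 + ‖x‖) ^ Nv) := by gcongr; exact le_abs_self _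
      _ = |Cv| * ((1 + ‖x‖) ^ Nv * ‖g x‖) := by ring
  have hvT_le : ∀ z, ‖vT z‖ ≤ |Cv| * (1 + ‖z‖) ^ Nv := fun z => by
    refine (norm_ι_δ_translate_le hE1 hE2 (G z.2) (hpos z.2) (abs_nonneg z.1)).trans ((hCv z.2).trans ?_)
    calc Cv * (1 + ‖z.2‖) ^ Nv ≤ |Cv| * (1 + ‖z.2‖) ^ Nv := mul_le_mul_of_nonneg_right (le_abs_self _) (by positivity)
      _ ≤ |Cv| * (1 + ‖z‖) ^ Nv := by gcongr; exact norm_snd_le z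
  -- integrability of the weight on the product space
  have hρcs : ∀ N : ℕ, HasCompactSupport (fun s : ℝ => (1 + |s|) ^ N * |ρ s|) := fun N =>
    HasCompactSupport.intro (K := Icc 0 L) isCompact_Icc fun s hs => by
      rw [hρsupp s hs, abs_zero, mul_zero]
  have hρc : ∀ N : ℕ, Continuous fun s : ℝ => (1 + |s|) ^ N * |ρ s| := fun N =>
    ((continuous_const.add continuous_abs).pow N).mul (continuous_abs.comp hρ)
  have hρint : ∀ N : ℕ, Integrable (fun s : ℝ => (1 + |s|) ^ N * |ρ s|) := fun N =>
    (hρc N).integrable_of_hasCompactSupport (hρcs N)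
  have hnorm_prod : ∀ (z : ℝ × X) (N : ℕ), (1 + ‖z‖) ^ N ≤ (1 + |z.1|) ^ N * (1 + ‖z.2‖) ^ N := by
    intro z N
    rw [← mul_pow]
    refine pow_le_pow_left₀ (by positivity) ?_ N
    have h1 : ‖z‖ ≤ |z.1| + ‖z.2‖ := by
      rw [Prod.norm_def, Real.norm_eq_abs]
      exact max_le (by linarith [norm_nonneg z.2]) (by linarith [abs_nonneg z.1])
    nlinarith [abs_nonneg z.1, norm_nonneg z.2]
  have hwc : Continuous fun z : ℝ × X => (ρ z.1 : ℂ) * g z.2 :=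
    (Complex.continuous_ofReal.comp (hρ.comp continuous_fst)).mul (hg.comp continuous_snd)
  have hwi : ∀ N : ℕ, Integrable (fun z : ℝ × X => (1 + ‖z‖) ^ N * ‖(ρ z.1 : ℂ) * g z.2‖) ((volume : Measure ℝ).prod μ) := by
    intro N
    refine ((hρint N).mul_prod (hgi N)).mono' ?_ (Eventually.of_forall fun z => ?_)
    · exact (((continuous_const.add continuous_norm).pow N).mul hwc.norm).aestronglyMeasurable
    · rw [Real.norm_eq_abs, abs_of_nonneg (by positivity), norm_mul, Complex.norm_real, Real.norm_eq_abs]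
      calc (1 + ‖z‖) ^ N * (|ρ z.1| * ‖g z.2‖) ≤ ((1 + |z.1|) ^ N * (1 + ‖z.2‖) ^ N) * (|ρ z.1| * ‖g z.2‖) :=
            mul_le_mul_of_nonneg_right (hnorm_prod z N) (by positivity)
        _ = (1 + |z.1|) ^ N * |ρ z.1| * ((1 + ‖z.2‖) ^ N * ‖g z.2‖) := by ring
  -- the superposed-vector identity for the translated family on `ℝ × X`
  have hident := ι_δ_mkGen_eq_integral hE2 (μ := ((volume : Measure ℝ).prod μ)) (translatedFamily G)
    (continuous_translatedFamily hG) (growth_translatedFamily hgrowth) (isPositiveTimeMulti_translatedFamily hpos)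
    ⟨|Cv|, Nv, hvT_le⟩ (fun z => (ρ z.1 : ℂ) * g z.2) hwc hwi K hK hKpos
  rw [hident, intervalIntegral.integral_of_le hL.le]
  -- `∫_{(0,L]} ρ(s) e^{-sH} V ds = ∫_ℝ ρ(s) e^{-|s|H} V ds`
  have hρ00 : ρ 0 = 0 := eq_zero_at_zero_of_support hρ hρsupp
  have hline : ∫ s in Ioc 0 L, (ρ s : ℂ) • shiftH hE2 s V = ∫ s, (ρ s : ℂ) • shiftH hE2 |s| V := by
    rw [← MeasureTheory.integral_indicator measurableSet_Ioc]
    refine integral_congr_ae (Eventually.of_forall fun s => ?_)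
    change (Ioc 0 L).indicator (fun s => (ρ s : ℂ) • shiftH hE2 s V) s = (ρ s : ℂ) • shiftH hE2 |s| V
    by_cases hs : s ∈ Ioc 0 L
    · rw [indicator_of_mem hs, abs_of_pos hs.1]
    · rw [indicator_of_notMem hs]
      have hρs : ρ s = 0 := by
        by_cases hs0 : s = 0
        · rw [hs0]; exact hρ00
        · exact hρsupp s fun h => hs ⟨lt_of_le_of_ne h.1 (Ne.symm hs0), h.2⟩
      rw [hρs, Complex.ofReal_zero, zero_smul]
  rw [hline]
  -- `e^{-|s|H} V = ∫ g(x) v((G x)(· - |s|e₀)) dμ`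
  have hinner : ∀ s : ℝ, shiftH hE2 |s| V = ∫ x, g x • vT (s, x) ∂μ := by
    intro s
    rw [hV, ← (shiftH hE2 |s|).integral_comp_comm hvG]
    refine integral_congr_ae (Eventually.of_forall fun x => ?_)
    change shiftH hE2 |s| (g x • vG x) = g x • vT (s, x)
    rw [ContinuousLinearMap.map_smul, hvTdef, hvGdef]
    simp only
    rw [shiftH_ι_δ_mkGen hE1 hE2 (G x) (hpos x) (abs_nonneg s)]
    rfl
  simp_rw [hinner]
  -- Fubini
  have hvTc : Continuous vT := continuous_ι_δ_mkGen hE2 (continuous_translatedFamily hG) _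
  have hF : Integrable (fun z : ℝ × X => ((ρ z.1 : ℂ) * g z.2) • vT z) ((volume : Measure ℝ).prod μ) := by
    refine (((hρint 0).mul_prod ((hgi Nv).const_mul |Cv|))).mono' ((hwc.smul hvTc).aestronglyMeasurable)
      (Eventually.of_forall fun z => ?_)
    rw [norm_smul, norm_mul, Complex.norm_real, Real.norm_eq_abs]
    have hvz : ‖vT z‖ ≤ |Cv| * (1 + ‖z.2‖) ^ Nv :=
      (norm_ι_δ_translate_le hE1 hE2 (G z.2) (hpos z.2) (abs_nonneg z.1)).trans
        ((hCv z.2).trans (mul_le_mul_of_nonneg_right (le_abs_self _) (by positivity)))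
    calc |ρ z.1| * ‖g z.2‖ * ‖vT z‖ ≤ |ρ z.1| * ‖g z.2‖ * (|Cv| * (1 + ‖z.2‖) ^ Nv) :=
          mul_le_mul_of_nonneg_left hvz (by positivity)
      _ = (1 + |z.1|) ^ 0 * |ρ z.1| * (|Cv| * ((1 + ‖z.2‖) ^ Nv * ‖g z.2‖)) := by ring
  rw [integral_prod _ hF]
  refine integral_congr_ae (Eventually.of_forall fun s => ?_)
  change (ρ s : ℂ) • ∫ x, g x • vT (s, x) ∂μ = ∫ x, ((ρ (s, x).1 : ℂ) * g (s, x).2) • vT (s, x) ∂μ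
  rw [← MeasureTheory.integral_smul]
  refine integral_congr_ae (Eventually.of_forall fun x => ?_)
  change (ρ s : ℂ) • (g x • vT (s, x)) = ((ρ s : ℂ) * g x) • vT (s, x)
  rw [mul_smul]

end Damping


end Literature.MathematicalPhysics.QuantumFieldTheory
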